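import Mathlib

/-!
# Closed forms for the dimension-0 `E = ∅` units (types (2,2,2,2,3,4), (2,2,2,2,2,5)) — pub-hsemireg, S4-PUSH corner 2

Kernel leg of seat s4-search-2 gen 16 (cell `pub-hsemireg`), ROW N1 of three (N1 this file, PLAIN; N2
`DimZeroUnitsClassDead.lean`; N3 `DimZeroUnitsClassDeadFive.lean`).  Ring identities only, in an arbitrary commutative
ring `R` whose «slots» `η₀, …, η₅` square to zero (in the application `R = Λ^{ev}ℤ¹²`, the commutative 2-vector
subalgebra of `ExteriorAlgebra ℤ M`, `ηᵢ = ι x₂ᵢ ι x₂ᵢ₊₁`): for the two types `D = 4(η₀ + η₁ + η₂ + η₃) + 8η₄ + 16η₅`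
(c′ = (2,2,2,2,3,4)) and `D = 4(η₀ + ⋯ + η₄) + 32η₅` (c′ = (2,2,2,2,2,5)) the divided powers `D^[2], D^[3], D^[4]`
have the printed closed forms (`D·D = 2D^[2]`, `D^[2]·D = 3D^[3]`, `D^[3]·D = 4D^[4]`, each by `linear_combination`
with explicit multipliers of the `ηᵢ² = 0`), `P·P^[2] = 3P^[3]` for the elementary symmetric functions of the
`c′ = 2` slots, and `(2βX + 4X₂)² = 16(βXX₂ + X₂²)` for `β² = 0`; plus the two Mathlib facts used by the degree-8
coefficient functional of N2 (`prod_eight_eq_ιMulti`, `projEight_basis`).  PRECISION (s4-ref g47, N-1): in this file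
`D^[2], D^[3], D^[4]` (and `P^[j]`) are NAMES for the printed ring elements — the theorems say `D·D = 2·(printed)`,
`(printed₂)·D = 3·(printed₃)`, `(printed₃)·D = 4·(printed₄)` in any commutative ring with the slot relations; that these
printed elements ARE the divided powers of `D` (unique in the 2-torsion-free `Λ^{ev}ℤ¹²`) is established in N2, which
cancels `2`, `6`, `24` (`LeadingDigitRemainder.natCast_mul_cancel`) against the INTRINSIC hypotheses `D·D = 2D₂`,
`D·D·D = 6D₃`, `D·D·D·D = 24D₄` of its theorem; nothing here defines a divided power.  Count-neutral (theorems only, no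
`def`); no object, no `σ`, no Hodge statement; nothing here bears on HC ∕ HC_CM ∕ HC_AV.
-/

namespace Summit.Ventures.HSemireg.DimZeroClosedForms

open ExteriorAlgebra

section ClosedForms

/-! ### 1. Closed forms in a commutative ring (slots square to zero) -/

variable {R : Type*} [CommRing R]

/-- Type (2,2,2,2,3,4): `D·D = 2·D^[2]` with `D^[2] = 16P^[2] + 32Pη₄ + 64Pη₅ + 128η₄η₅`. -/
theorem sq_D_c34 (η₀ η₁ η₂ η₃ η₄ η₅ δ : R) (hδ : δ = 4 * (η₀ + η₁ + η₂ + η₃) + 8 * η₄ + 16 * η₅)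
    (q₀ : η₀ * η₀ = 0) (q₁ : η₁ * η₁ = 0) (q₂ : η₂ * η₂ = 0) (q₃ : η₃ * η₃ = 0) (q₄ : η₄ * η₄ = 0)
    (q₅ : η₅ * η₅ = 0) :
    δ * δ = 2 * (16 * (η₀ * η₁ + η₀ * η₂ + η₀ * η₃ + η₁ * η₂ + η₁ * η₃ + η₂ * η₃)
      + 32 * ((η₀ + η₁ + η₂ + η₃) * η₄) + 64 * ((η₀ + η₁ + η₂ + η₃) * η₅) + 128 * (η₄ * η₅)) := by
  subst hδ
  linear_combination (16 : R) * q₀ + (16 : R) * q₁ + (16 : R) * q₂ + (16 : R) * q₃ + (64 : R) * q₄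
    + (256 : R) * q₅

/-- Type (2,2,2,2,3,4): `D^[2]·D = 3·D^[3]` with `D^[3] = 64P^[3] + 128P^[2]η₄ + 256P^[2]η₅ + 512Pη₄η₅`. -/
theorem D2_mul_D_c34 (η₀ η₁ η₂ η₃ η₄ η₅ δ : R) (hδ : δ = 4 * (η₀ + η₁ + η₂ + η₃) + 8 * η₄ + 16 * η₅)
    (q₀ : η₀ * η₀ = 0) (q₁ : η₁ * η₁ = 0) (q₂ : η₂ * η₂ = 0) (q₃ : η₃ * η₃ = 0) (q₄ : η₄ * η₄ = 0)
    (q₅ : η₅ * η₅ = 0) :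
    (16 * (η₀ * η₁ + η₀ * η₂ + η₀ * η₃ + η₁ * η₂ + η₁ * η₃ + η₂ * η₃)
      + 32 * ((η₀ + η₁ + η₂ + η₃) * η₄) + 64 * ((η₀ + η₁ + η₂ + η₃) * η₅) + 128 * (η₄ * η₅)) * δ
      = 3 * (64 * (η₀ * η₁ * η₂ + η₀ * η₁ * η₃ + η₀ * η₂ * η₃ + η₁ * η₂ * η₃)
        + 128 * ((η₀ * η₁ + η₀ * η₂ + η₀ * η₃ + η₁ * η₂ + η₁ * η₃ + η₂ * η₃) * η₄)
        + 256 * ((η₀ * η₁ + η₀ * η₂ + η₀ * η₃ + η₁ * η₂ + η₁ * η₃ + η₂ * η₃) * η₅)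
        + 512 * ((η₀ + η₁ + η₂ + η₃) * (η₄ * η₅))) := by
  subst hδ
  linear_combination (256 * η₅ + 128 * η₄ + 64 * η₃ + 64 * η₂ + 64 * η₁) * q₀
    + (256 * η₅ + 128 * η₄ + 64 * η₃ + 64 * η₂ + 64 * η₀) * q₁
    + (256 * η₅ + 128 * η₄ + 64 * η₃ + 64 * η₁ + 64 * η₀) * q₂
    + (256 * η₅ + 128 * η₄ + 64 * η₂ + 64 * η₁ + 64 * η₀) * q₃
    + (1024 * η₅ + 256 * η₃ + 256 * η₂ + 256 * η₁ + 256 * η₀) * q₄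
    + (2048 * η₄ + 1024 * η₃ + 1024 * η₂ + 1024 * η₁ + 1024 * η₀) * q₅

/-- Type (2,2,2,2,3,4): `D^[3]·D = 4·D^[4]` with `D^[4] = 256P^[4] + 512P^[3]η₄ + 1024P^[3]η₅ + 2048P^[2]η₄η₅`. -/
theorem D3_mul_D_c34 (η₀ η₁ η₂ η₃ η₄ η₅ δ : R) (hδ : δ = 4 * (η₀ + η₁ + η₂ + η₃) + 8 * η₄ + 16 * η₅)
    (q₀ : η₀ * η₀ = 0) (q₁ : η₁ * η₁ = 0) (q₂ : η₂ * η₂ = 0) (q₃ : η₃ * η₃ = 0) (q₄ : η₄ * η₄ = 0)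
    (q₅ : η₅ * η₅ = 0) :
    (64 * (η₀ * η₁ * η₂ + η₀ * η₁ * η₃ + η₀ * η₂ * η₃ + η₁ * η₂ * η₃)
        + 128 * ((η₀ * η₁ + η₀ * η₂ + η₀ * η₃ + η₁ * η₂ + η₁ * η₃ + η₂ * η₃) * η₄)
        + 256 * ((η₀ * η₁ + η₀ * η₂ + η₀ * η₃ + η₁ * η₂ + η₁ * η₃ + η₂ * η₃) * η₅)
        + 512 * ((η₀ + η₁ + η₂ + η₃) * (η₄ * η₅))) * δ
      = 4 * (256 * (η₀ * η₁ * η₂ * η₃)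
        + 512 * ((η₀ * η₁ * η₂ + η₀ * η₁ * η₃ + η₀ * η₂ * η₃ + η₁ * η₂ * η₃) * η₄)
        + 1024 * ((η₀ * η₁ * η₂ + η₀ * η₁ * η₃ + η₀ * η₂ * η₃ + η₁ * η₂ * η₃) * η₅)
        + 2048 * ((η₀ * η₁ + η₀ * η₂ + η₀ * η₃ + η₁ * η₂ + η₁ * η₃ + η₂ * η₃) * (η₄ * η₅))) := by
  subst hδ
  linear_combination (2048 * η₄ * η₅ + 1024 * η₃ * η₅ + 512 * η₃ * η₄ + 1024 * η₂ * η₅ + 512 * η₂ * η₄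
      + 256 * η₂ * η₃ + 1024 * η₁ * η₅ + 512 * η₁ * η₄ + 256 * η₁ * η₃ + 256 * η₁ * η₂) * q₀
    + (2048 * η₄ * η₅ + 1024 * η₃ * η₅ + 512 * η₃ * η₄ + 1024 * η₂ * η₅ + 512 * η₂ * η₄ + 256 * η₂ * η₃
      + 1024 * η₀ * η₅ + 512 * η₀ * η₄ + 256 * η₀ * η₃ + 256 * η₀ * η₂) * q₁
    + (2048 * η₄ * η₅ + 1024 * η₃ * η₅ + 512 * η₃ * η₄ + 1024 * η₁ * η₅ + 512 * η₁ * η₄ + 256 * η₁ * η₃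
      + 1024 * η₀ * η₅ + 512 * η₀ * η₄ + 256 * η₀ * η₃ + 256 * η₀ * η₁) * q₂
    + (2048 * η₄ * η₅ + 1024 * η₂ * η₅ + 512 * η₂ * η₄ + 1024 * η₁ * η₅ + 512 * η₁ * η₄ + 256 * η₁ * η₂
      + 1024 * η₀ * η₅ + 512 * η₀ * η₄ + 256 * η₀ * η₂ + 256 * η₀ * η₁) * q₃
    + (4096 * η₃ * η₅ + 4096 * η₂ * η₅ + 1024 * η₂ * η₃ + 4096 * η₁ * η₅ + 1024 * η₁ * η₃ + 1024 * η₁ * η₂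
      + 4096 * η₀ * η₅ + 1024 * η₀ * η₃ + 1024 * η₀ * η₂ + 1024 * η₀ * η₁) * q₄
    + (8192 * η₃ * η₄ + 8192 * η₂ * η₄ + 4096 * η₂ * η₃ + 8192 * η₁ * η₄ + 4096 * η₁ * η₃ + 4096 * η₁ * η₂
      + 8192 * η₀ * η₄ + 4096 * η₀ * η₃ + 4096 * η₀ * η₂ + 4096 * η₀ * η₁) * q₅

/-- Four slots: `P·P^[2] = 3·P^[3]`. -/
theorem P_mul_P2_four (η₀ η₁ η₂ η₃ : R) (q₀ : η₀ * η₀ = 0) (q₁ : η₁ * η₁ = 0) (q₂ : η₂ * η₂ = 0)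
    (q₃ : η₃ * η₃ = 0) :
    (η₀ + η₁ + η₂ + η₃) * (η₀ * η₁ + η₀ * η₂ + η₀ * η₃ + η₁ * η₂ + η₁ * η₃ + η₂ * η₃)
      = 3 * (η₀ * η₁ * η₂ + η₀ * η₁ * η₃ + η₀ * η₂ * η₃ + η₁ * η₂ * η₃) := by
  linear_combination (η₃ + η₂ + η₁) * q₀ + (η₃ + η₂ + η₀) * q₁ + (η₃ + η₁ + η₀) * q₂ + (η₂ + η₁ + η₀) * q₃

/-- Type (2,2,2,2,2,5): `D·D = 2·D^[2]` with `D^[2] = 16P^[2] + 128Pη₅`. -/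
theorem sq_D_c25 (η₀ η₁ η₂ η₃ η₄ η₅ δ : R) (hδ : δ = 4 * (η₀ + η₁ + η₂ + η₃ + η₄) + 32 * η₅)
    (q₀ : η₀ * η₀ = 0) (q₁ : η₁ * η₁ = 0) (q₂ : η₂ * η₂ = 0) (q₃ : η₃ * η₃ = 0) (q₄ : η₄ * η₄ = 0)
    (q₅ : η₅ * η₅ = 0) :
    δ * δ = 2 * (16 * (η₀ * η₁ + η₀ * η₂ + η₀ * η₃ + η₀ * η₄ + η₁ * η₂ + η₁ * η₃ + η₁ * η₄ + η₂ * η₃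
      + η₂ * η₄ + η₃ * η₄) + 128 * ((η₀ + η₁ + η₂ + η₃ + η₄) * η₅)) := by
  subst hδ
  linear_combination (16 : R) * q₀ + (16 : R) * q₁ + (16 : R) * q₂ + (16 : R) * q₃ + (16 : R) * q₄
    + (1024 : R) * q₅

/-- Type (2,2,2,2,2,5): `D^[2]·D = 3·D^[3]` with `D^[3] = 64P^[3] + 512P^[2]η₅`. -/
theorem D2_mul_D_c25 (η₀ η₁ η₂ η₃ η₄ η₅ δ : R) (hδ : δ = 4 * (η₀ + η₁ + η₂ + η₃ + η₄) + 32 * η₅)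
    (q₀ : η₀ * η₀ = 0) (q₁ : η₁ * η₁ = 0) (q₂ : η₂ * η₂ = 0) (q₃ : η₃ * η₃ = 0) (q₄ : η₄ * η₄ = 0)
    (q₅ : η₅ * η₅ = 0) :
    (16 * (η₀ * η₁ + η₀ * η₂ + η₀ * η₃ + η₀ * η₄ + η₁ * η₂ + η₁ * η₃ + η₁ * η₄ + η₂ * η₃ + η₂ * η₄
      + η₃ * η₄) + 128 * ((η₀ + η₁ + η₂ + η₃ + η₄) * η₅)) * δ
      = 3 * (64 * (η₀ * η₁ * η₂ + η₀ * η₁ * η₃ + η₀ * η₁ * η₄ + η₀ * η₂ * η₃ + η₀ * η₂ * η₄ + η₀ * η₃ * η₄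
        + η₁ * η₂ * η₃ + η₁ * η₂ * η₄ + η₁ * η₃ * η₄ + η₂ * η₃ * η₄)
        + 512 * ((η₀ * η₁ + η₀ * η₂ + η₀ * η₃ + η₀ * η₄ + η₁ * η₂ + η₁ * η₃ + η₁ * η₄ + η₂ * η₃ + η₂ * η₄
          + η₃ * η₄) * η₅)) := by
  subst hδ
  linear_combination (512 * η₅ + 64 * η₄ + 64 * η₃ + 64 * η₂ + 64 * η₁) * q₀
    + (512 * η₅ + 64 * η₄ + 64 * η₃ + 64 * η₂ + 64 * η₀) * q₁
    + (512 * η₅ + 64 * η₄ + 64 * η₃ + 64 * η₁ + 64 * η₀) * q₂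
    + (512 * η₅ + 64 * η₄ + 64 * η₂ + 64 * η₁ + 64 * η₀) * q₃
    + (512 * η₅ + 64 * η₃ + 64 * η₂ + 64 * η₁ + 64 * η₀) * q₄
    + (4096 * η₄ + 4096 * η₃ + 4096 * η₂ + 4096 * η₁ + 4096 * η₀) * q₅

/-- Type (2,2,2,2,2,5): `D^[3]·D = 4·D^[4]` with `D^[4] = 256P^[4] + 2048P^[3]η₅`. -/
theorem D3_mul_D_c25 (η₀ η₁ η₂ η₃ η₄ η₅ δ : R) (hδ : δ = 4 * (η₀ + η₁ + η₂ + η₃ + η₄) + 32 * η₅)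
    (q₀ : η₀ * η₀ = 0) (q₁ : η₁ * η₁ = 0) (q₂ : η₂ * η₂ = 0) (q₃ : η₃ * η₃ = 0) (q₄ : η₄ * η₄ = 0)
    (q₅ : η₅ * η₅ = 0) :
    (64 * (η₀ * η₁ * η₂ + η₀ * η₁ * η₃ + η₀ * η₁ * η₄ + η₀ * η₂ * η₃ + η₀ * η₂ * η₄ + η₀ * η₃ * η₄
        + η₁ * η₂ * η₃ + η₁ * η₂ * η₄ + η₁ * η₃ * η₄ + η₂ * η₃ * η₄)
        + 512 * ((η₀ * η₁ + η₀ * η₂ + η₀ * η₃ + η₀ * η₄ + η₁ * η₂ + η₁ * η₃ + η₁ * η₄ + η₂ * η₃ + η₂ * η₄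
          + η₃ * η₄) * η₅)) * δ
      = 4 * (256 * (η₀ * η₁ * η₂ * η₃ + η₀ * η₁ * η₂ * η₄ + η₀ * η₁ * η₃ * η₄ + η₀ * η₂ * η₃ * η₄
        + η₁ * η₂ * η₃ * η₄)
        + 2048 * ((η₀ * η₁ * η₂ + η₀ * η₁ * η₃ + η₀ * η₁ * η₄ + η₀ * η₂ * η₃ + η₀ * η₂ * η₄ + η₀ * η₃ * η₄
          + η₁ * η₂ * η₃ + η₁ * η₂ * η₄ + η₁ * η₃ * η₄ + η₂ * η₃ * η₄) * η₅)) := by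
  subst hδ
  linear_combination (2048 * η₄ * η₅ + 2048 * η₃ * η₅ + 256 * η₃ * η₄ + 2048 * η₂ * η₅ + 256 * η₂ * η₄
      + 256 * η₂ * η₃ + 2048 * η₁ * η₅ + 256 * η₁ * η₄ + 256 * η₁ * η₃ + 256 * η₁ * η₂) * q₀
    + (2048 * η₄ * η₅ + 2048 * η₃ * η₅ + 256 * η₃ * η₄ + 2048 * η₂ * η₅ + 256 * η₂ * η₄ + 256 * η₂ * η₃
      + 2048 * η₀ * η₅ + 256 * η₀ * η₄ + 256 * η₀ * η₃ + 256 * η₀ * η₂) * q₁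
    + (2048 * η₄ * η₅ + 2048 * η₃ * η₅ + 256 * η₃ * η₄ + 2048 * η₁ * η₅ + 256 * η₁ * η₄ + 256 * η₁ * η₃
      + 2048 * η₀ * η₅ + 256 * η₀ * η₄ + 256 * η₀ * η₃ + 256 * η₀ * η₁) * q₂
    + (2048 * η₄ * η₅ + 2048 * η₂ * η₅ + 256 * η₂ * η₄ + 2048 * η₁ * η₅ + 256 * η₁ * η₄ + 256 * η₁ * η₂
      + 2048 * η₀ * η₅ + 256 * η₀ * η₄ + 256 * η₀ * η₂ + 256 * η₀ * η₁) * q₃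
    + (2048 * η₃ * η₅ + 2048 * η₂ * η₅ + 256 * η₂ * η₃ + 2048 * η₁ * η₅ + 256 * η₁ * η₃ + 256 * η₁ * η₂
      + 2048 * η₀ * η₅ + 256 * η₀ * η₃ + 256 * η₀ * η₂ + 256 * η₀ * η₁) * q₄
    + (16384 * η₃ * η₄ + 16384 * η₂ * η₄ + 16384 * η₂ * η₃ + 16384 * η₁ * η₄ + 16384 * η₁ * η₃
      + 16384 * η₁ * η₂ + 16384 * η₀ * η₄ + 16384 * η₀ * η₃ + 16384 * η₀ * η₂ + 16384 * η₀ * η₁) * q₅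

/-- Five slots: `P·P^[2] = 3·P^[3]`. -/
theorem P_mul_P2_five (η₀ η₁ η₂ η₃ η₄ : R) (q₀ : η₀ * η₀ = 0) (q₁ : η₁ * η₁ = 0) (q₂ : η₂ * η₂ = 0)
    (q₃ : η₃ * η₃ = 0) (q₄ : η₄ * η₄ = 0) :
    (η₀ + η₁ + η₂ + η₃ + η₄) * (η₀ * η₁ + η₀ * η₂ + η₀ * η₃ + η₀ * η₄ + η₁ * η₂ + η₁ * η₃ + η₁ * η₄
      + η₂ * η₃ + η₂ * η₄ + η₃ * η₄)
      = 3 * (η₀ * η₁ * η₂ + η₀ * η₁ * η₃ + η₀ * η₁ * η₄ + η₀ * η₂ * η₃ + η₀ * η₂ * η₄ + η₀ * η₃ * η₄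
        + η₁ * η₂ * η₃ + η₁ * η₂ * η₄ + η₁ * η₃ * η₄ + η₂ * η₃ * η₄) := by
  linear_combination (η₄ + η₃ + η₂ + η₁) * q₀ + (η₄ + η₃ + η₂ + η₀) * q₁ + (η₄ + η₃ + η₁ + η₀) * q₂
    + (η₄ + η₂ + η₁ + η₀) * q₃ + (η₃ + η₂ + η₁ + η₀) * q₄

/-- The square of the half divided square of `β + 2X` (`β² = 0`): `(2βX + 4X₂)² = 16·(βXX₂ + X₂X₂)`. -/
theorem sq_halfSquare (C X X₂ : R) (qC : C * C = 0) :
    (2 * (C * X) + 4 * X₂) * (2 * (C * X) + 4 * X₂) = 16 * (C * X * X₂ + X₂ * X₂) := by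
  linear_combination (4 * X * X) * qC

end ClosedForms

section Functionals

/-! ### 2. The degree-8 coefficient functional -/

/-- The eight-fold product `ι e₀ · (ι e₁ · (⋯ · ι e₇))` in `Λ(R⁸)` is `ιMulti R 8 e`. -/
theorem prod_eight_eq_ιMulti (R : Type*) [CommRing R] :
    ι R (Pi.single 0 1 : Fin 8 → R) * (ι R (Pi.single 1 1 : Fin 8 → R) * (ι R (Pi.single 2 1 : Fin 8 → R)
      * (ι R (Pi.single 3 1 : Fin 8 → R) * (ι R (Pi.single 4 1 : Fin 8 → R) * (ι R (Pi.single 5 1 : Fin 8 → R)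
      * (ι R (Pi.single 6 1 : Fin 8 → R) * ι R (Pi.single 7 1 : Fin 8 → R)))))))
      = ιMulti R 8 (fun i => (Pi.single i 1 : Fin 8 → R)) := by
  rw [ιMulti_apply]
  simp [List.ofFn_succ]

variable {M : Type*} [AddCommGroup M] [Module ℤ M]

/-- The projection `M → ℤ⁸` to the coordinates `0, …, 7` of a basis `b`: `b 0, …, b 7 ↦ e₀, …, e₇`, `b 8, … ↦ 0`. -/
theorem projEight_basis (b : Module.Basis (Fin 12) ℤ M) (i : Fin 12) :
    (LinearMap.funLeft ℤ ℤ (Fin.castLE (show 8 ≤ 12 by decide)) ∘ₗ (b.equivFun : M →ₗ[ℤ] (Fin 12 → ℤ))) (b i)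
      = (![Pi.single 0 1, Pi.single 1 1, Pi.single 2 1, Pi.single 3 1, Pi.single 4 1, Pi.single 5 1,
          Pi.single 6 1, Pi.single 7 1, 0, 0, 0, 0] : Fin 12 → (Fin 8 → ℤ)) i := by
  funext j
  simp only [LinearMap.coe_comp, Function.comp_apply, LinearMap.funLeft_apply, LinearEquiv.coe_coe,
    Module.Basis.equivFun_self, Fin.ext_iff, Fin.val_castLE]
  fin_cases i <;> fin_cases j <;> simp

end Functionals

end Summit.Ventures.HSemireg.DimZeroClosedForms
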